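import Summits.NavierStokesRegularity.NavierStokesRegularity.Theses.TypeILiouville
import Summits.NavierStokesRegularity.NavierStokesRegularity.Theorems.TypeILiouvilleTypeIliouvilleNoTypeIIStubTimeDoubling
import Summits.NavierStokesRegularity.NavierStokesRegularity.Theorems.TypeILiouvilleTypeIliouvilleNoTypeIIStubSupNorm
import Summits.NavierStokesRegularity.NavierStokesRegularity.Theorems.TypeILiouvilleTypeIliouvilleNoTypeIIStubEternalLiouvilleOfL
import Summits.NavierStokesRegularity.NavierStokesRegularity.Theorems.TypeILiouvilleTypeIliouvilleNoTypeIIStubActiveWindows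
import Literature.Analysis.FluidPDE.TypeIAncientMild
import HarnessLib

/-!
# `TypeIliouvilleNoTypeII` (stmt-NavierStokesRegularity-0056) — line `Sketch` (immortal zoom)

Skeleton of the lead prover (crux protocol, MODE: LINE), revision 4. The crux (`NoTypeII`, shared
by 15+ routes): a maximal smooth solution of Navier–Stokes on `ℝ³ × [0, T)`, `0 < T < ∞`, which is
Leray–Hopf from a rapidly decaying datum blows up at the Type I rate
`‖u(t)‖_∞ ≤ C (T - t)^{-1/2}`.

Line (Poláčik–Quittner–Souplet time doubling ⇒ a Type-II singularity generates a bounded ETERNAL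
mild solution; "Type II is slow, so its model is immortal"), as reshaped by the lead:

1. `stub_timeDoubling` — LANDED (`TypeILiouvilleTypeIliouvilleNoTypeIIStubTimeDoubling`, p136683):
   the PQS doubling lemma on the time axis with the parabolic distance.
2. `stub_supNorm` — LANDED (`TypeILiouvilleTypeIliouvilleNoTypeIIStubSupNorm`, p136636): the
   sup-norm modulus of a blowing-up Clay solution (finite, continuous, Leray lower bound).
3. `stub_activeWindowsGenerateNonconstant` — LANDED (the lead's stub;
   `TypeILiouvilleTypeIliouvilleNoTypeIIStubActiveWindows`, p137498, with helpers
   `…StubActiveWindows{Regularity,Boxes,Extraction,Zoom}`, p136869/p137057/p137351/p136976): active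
   sup-controlled windows of rescaled half-length `k → ∞` generate a bounded ETERNAL Oseen-mild
   smooth field `v` with `‖∇v(0, 0)‖ ≥ ε` (the two-sided zoom + KNSS §4 compactness).
4. `stub_windowActivity` — RESIDUAL (open: "no depleted Type-II blow-up"), revision 2 (the ∀∃ form,
   weaker than revision 1's "every long window is active"): there are `ε > 0`, `k₀`, `t₁ < T` such
   that for `k ≥ k₀` and `t₂ ∈ [t₁, T)`, IF some sup-controlled two-sided window of parameter `k`
   is centred beyond `t₂`, THEN some sup-controlled window of parameter `k` centred beyond `t₂` has
   an `ε`-active centre (`ε M² ≤ ν ‖∇u(t, x₀)‖`).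
5. `stub_eternalLiouville` — RESIDUAL (open; weaker than KNSS's conjecture (L) = item
   `TypeIliouvilleL`): bounded eternal Oseen-mild smooth fields on `ℝ × ℝ³` have zero gradient.
6. `stub_eternalLiouville_of_liouvilleConjecture` — LANDED
   (`TypeILiouvilleTypeIliouvilleNoTypeIIStubEternalLiouvilleOfL`, p136626): (L) ⇒ STUB 5.

Glue (`TypeIliouvilleNoTypeII_of_eternalLiouville`, sorry-free): not Type I ⇒
`‖u(t)‖_∞ √(T - t)` unbounded ⇒ (1)+(2) long sup-controlled windows for every `k` beyond every
`t₂ < T` ⇒ (4) active windows of every parameter ⇒ (3) a non-constant bounded eternal field ⇒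
contradiction with the eternal Liouville hypothesis; `TypeIliouvilleNoTypeII_of` feeds it STUB 5,
`TypeIliouvilleNoTypeII_of_L` feeds it (L) + STUB 6.
-/

noncomputable section

-- the summit and its single problem share the name `NavierStokesRegularity` (D-0017 nested layout)
set_option linter.dupNamespace false

open Set Function Filter Topology MeasureTheory Metric
open scoped NNReal ENNReal

namespace Summit.NavierStokesRegularity.NavierStokesRegularity.Theorems

open Literature.Analysis Literature.Analysis.FluidPDE
open Summit.NavierStokesRegularity.NavierStokesRegularity.Theorems.TypeIliouvilleNoTypeII.ImmortalZoom

/-- `ℝ³`. -/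
local notation "E3" => EuclideanSpace ℝ (Fin 3)

/-! ## Stubs (the two open residuals; STUBS 1, 2, 3, 6 are imported from the tree) -/

/-- STUB 4 — RESIDUAL, OPEN ("no depleted Type-II blow-up"), revision 2 (∀∃ form). For a maximal
smooth Leray–Hopf solution from a rapidly decaying datum there are `ε > 0`, `k₀` and `t₁ < T` such
that for every parameter `k ≥ k₀` and every `t₂ ∈ [t₁, T)`: if SOME sup-controlled two-sided window
`[t - kν/M², t + kν/M²] ⊂ (0, T)` (`‖u‖ ≤ 2M` on it, `M ≤ 2‖u(t, x)‖` somewhere) is centred at a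
time `t > t₂`, then SOME sup-controlled window `[t' - kν/M'², t' + kν/M'²] ⊂ (0, T)` (`‖u‖ ≤ M'` on
it) centred at a time `t' > t₂` has an `ε`-active centre, `ε M'² ≤ ν ‖∇u(t', x₀)‖`. Vacuous for
Type-I blow-ups (no long windows); its negation is a Type-II singularity which is eventually
depleted at some scale; false for Tao's averaged cascade, so not provable by averaging-blind means. -/
theorem stub_windowActivity (ν T : ℝ) (hν : 0 < ν) (hT : 0 < T) (u : ℝ → E3 → E3)
    (p : ℝ → E3 → ℝ) (hmax : IsMaximalSmoothSolution ν 0 u p T)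
    (hLH : IsLerayHopfOn T ν 0 (u 0) u) (hdec : HasRapidSpatialDecay (u 0)) :
    ∃ ε k₀ t₁ : ℝ, 0 < ε ∧ t₁ < T ∧ ∀ k t₂ : ℝ, k₀ ≤ k → t₁ ≤ t₂ → t₂ < T →
      (∃ t M : ℝ, t₂ < t ∧ 0 < M ∧ Icc (t - k * ν / M ^ 2) (t + k * ν / M ^ 2) ⊆ Ioo 0 T ∧
        (∀ s ∈ Icc (t - k * ν / M ^ 2) (t + k * ν / M ^ 2), ∀ x, ‖u s x‖ ≤ 2 * M) ∧
        ∃ x, M ≤ 2 * ‖u t x‖) →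
      ∃ t M : ℝ, ∃ x₀ : E3, t₂ < t ∧ 0 < M ∧
        Icc (t - k * ν / M ^ 2) (t + k * ν / M ^ 2) ⊆ Ioo 0 T ∧
        (∀ s ∈ Icc (t - k * ν / M ^ 2) (t + k * ν / M ^ 2), ∀ x, ‖u s x‖ ≤ M) ∧
        ε * M ^ 2 ≤ ν * ‖fderiv ℝ (u t) x₀‖ := by
  sorry

/-- STUB 5 — RESIDUAL, OPEN (eternal Liouville; weaker than KNSS's conjecture (L), item
`TypeIliouvilleL`, and containing the open "bounded steady flows on `ℝ³` are constant",
Koch–Nadirashvili–Seregin–Šverák 2009 p. 9). A bounded smooth divergence-free field on `ℝ × ℝ³`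
satisfying the Oseen integral equation `v(t) = e^{(t-s)Δ}v(s) - B¹_s(v, v)(t)` between every pair
of times `s < t` (a bounded ETERNAL mild solution, unit viscosity) has identically vanishing
spatial gradient. -/
theorem stub_eternalLiouville (v : ℝ → E3 → E3) (hv : ContDiff ℝ (⊤ : ℕ∞) (uncurry v))
    (hdiv : ∀ t, VectorCalculus.IsDivFree (v t))
    (hmild : ∀ s t : ℝ, s < t → ∀ x, v t x = heatFlow (v s) (t - s) x - oseenDuhamel 1 s v v t x)
    (hbdd : ∃ C : ℝ, ∀ t x, ‖v t x‖ ≤ C) : ∀ t x, fderiv ℝ (v t) x = 0 := by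
  sorry

/-! ## Glue -/

/-- Not Type I ⇒ any pointwise majorant `m` of the slices has `m(t) √(T - t)` unbounded as `t ↑ T`.
[folklore] -/
theorem unbounded_of_not_isTypeIBlowup {T : ℝ} {u : ℝ → E3 → E3} {m : ℝ → ℝ}
    (hm : ∀ t ∈ Ico 0 T, ∀ x, ‖u t x‖ ≤ m t) (hT : 0 < T) (hII : ¬ IsTypeIBlowup u T) :
    ∀ K : ℝ, ∀ t₁ < T, ∃ t ∈ Ico 0 T, t₁ < t ∧ K < m t * Real.sqrt (T - t) := by
  intro K t₁ ht₁
  by_contra h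
  push Not at h
  apply hII
  refine ⟨K, ?_⟩
  have hmem : Ioo (max t₁ 0) T ∈ 𝓝[<] T :=
    Ioo_mem_nhdsLT (max_lt ht₁ hT)
  filter_upwards [hmem] with t ht x
  have ht0 : 0 ≤ t := (le_max_right _ _).trans ht.1.le
  have htT : t < T := ht.2
  have hK : m t * Real.sqrt (T - t) ≤ K := h t ⟨ht0, htT⟩ ((le_max_left _ _).trans_lt ht.1)
  have hs : 0 < Real.sqrt (T - t) := Real.sqrt_pos.2 (by linarith)
  rw [le_div_iff₀ hs]
  exact (mul_le_mul_of_nonneg_right (hm t ⟨ht0, htT⟩ x) hs.le).trans hK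

/-- **The crux from STUBS 1–4 and any eternal Liouville theorem** (the composition proper: the
window-activity statement enters as `hWA` — discharged by STUB 4 — and the eternal Liouville
statement as `hEL`, discharged by STUB 5 in `TypeIliouvilleNoTypeII_of` and by (L) + STUB 6 in
`TypeIliouvilleNoTypeII_of_L`). -/
theorem TypeIliouvilleNoTypeII_of_windowActivity_of_eternalLiouville
    (hWA : ∀ (ν T : ℝ), 0 < ν → 0 < T → ∀ (u : ℝ → E3 → E3) (p : ℝ → E3 → ℝ),
      IsMaximalSmoothSolution ν 0 u p T → IsLerayHopfOn T ν 0 (u 0) u →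
      HasRapidSpatialDecay (u 0) →
      ∃ ε k₀ t₁ : ℝ, 0 < ε ∧ t₁ < T ∧ ∀ k t₂ : ℝ, k₀ ≤ k → t₁ ≤ t₂ → t₂ < T →
        (∃ t M : ℝ, t₂ < t ∧ 0 < M ∧ Icc (t - k * ν / M ^ 2) (t + k * ν / M ^ 2) ⊆ Ioo 0 T ∧
          (∀ s ∈ Icc (t - k * ν / M ^ 2) (t + k * ν / M ^ 2), ∀ x, ‖u s x‖ ≤ 2 * M) ∧
          ∃ x, M ≤ 2 * ‖u t x‖) →
        ∃ t M : ℝ, ∃ x₀ : E3, t₂ < t ∧ 0 < M ∧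
          Icc (t - k * ν / M ^ 2) (t + k * ν / M ^ 2) ⊆ Ioo 0 T ∧
          (∀ s ∈ Icc (t - k * ν / M ^ 2) (t + k * ν / M ^ 2), ∀ x, ‖u s x‖ ≤ M) ∧
          ε * M ^ 2 ≤ ν * ‖fderiv ℝ (u t) x₀‖)
    (hEL : ∀ v : ℝ → E3 → E3, ContDiff ℝ (⊤ : ℕ∞) (uncurry v) →
      (∀ t, VectorCalculus.IsDivFree (v t)) →
      (∀ s t : ℝ, s < t → ∀ x, v t x = heatFlow (v s) (t - s) x - oseenDuhamel 1 s v v t x) →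
      (∃ C : ℝ, ∀ t x, ‖v t x‖ ≤ C) → ∀ t x, fderiv ℝ (v t) x = 0) :
    Summit.NavierStokesRegularity.NavierStokesRegularity.Theses.TypeILiouville.TypeIliouvilleNoTypeII := by
  intro ν T hν hT u p hmax hLH hdec
  by_contra hII
  -- the sup-norm modulus and the activity constants
  obtain ⟨m, hmc, hle, hnear, c, hc, hler⟩ := stub_supNorm ν T hν hT u p hmax hLH hdec
  obtain ⟨ε, k₀, t₁, hε, ht₁, hact⟩ := hWA ν T hν hT u p hmax hLH hdec
  have hpos : ∀ t ∈ Ico 0 T, 0 < m t := fun t ht =>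
    lt_of_lt_of_le (div_pos hc (Real.sqrt_pos.2 (by linarith [ht.2]))) (hler t ht)
  have hunb := unbounded_of_not_isTypeIBlowup hle hT hII
  -- active windows of every rescaled half-length `k`
  have hwin : ∀ k : ℕ, ∃ t M : ℝ, ∃ x₀ : E3, 0 < M ∧
      Icc (t - k * ν / M ^ 2) (t + k * ν / M ^ 2) ⊆ Ioo 0 T ∧
      (∀ s ∈ Icc (t - k * ν / M ^ 2) (t + k * ν / M ^ 2), ∀ x, ‖u s x‖ ≤ M) ∧
      ε * M ^ 2 ≤ ν * ‖fderiv ℝ (u t) x₀‖ := by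
    intro k
    -- a long doubling window with parameter `K = max k₀ k` beyond `t₂ = max t₁ 0`
    set K : ℝ := max (max k₀ k) 1 with hK
    have hK0 : 0 < K := lt_of_lt_of_le one_pos (le_max_right _ _)
    have hKν : 0 < Real.sqrt (K * ν) := Real.sqrt_pos.2 (mul_pos hK0 hν)
    obtain ⟨t, ht, ht₁t, -, hleft, hright, hdoub⟩ :=
      stub_timeDoubling (k := Real.sqrt (K * ν)) hKν hmc hpos hunb (max t₁ 0) (max_lt ht₁ hT)
    have hMt : 0 < m t := hpos t ht
    have hsq : Real.sqrt (K * ν) ^ 2 = K * ν := Real.sq_sqrt (mul_pos hK0 hν).le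
    rw [hsq] at hleft hright hdoub
    -- the doubling window is a sup-controlled window of parameter `K` and level `m t` beyond `t₂`
    have hsub : Icc (t - K * ν / m t ^ 2) (t + K * ν / m t ^ 2) ⊆ Ioo 0 T := fun s hs =>
      ⟨lt_of_lt_of_le hleft hs.1, lt_of_le_of_lt hs.2 hright⟩
    have hbd : ∀ s ∈ Icc (t - K * ν / m t ^ 2) (t + K * ν / m t ^ 2), ∀ x, ‖u s x‖ ≤ 2 * m t := by
      intro s hs x
      have hsI : s ∈ Ico 0 T := ⟨(hsub hs).1.le, (hsub hs).2⟩
      exact (hle s hsI x).trans (hdoub s hs)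
    have hnr : ∃ x, m t ≤ 2 * ‖u t x‖ := by
      obtain ⟨x, hx⟩ := hnear t ht (m t / 2) (by linarith)
      exact ⟨x, by linarith⟩
    obtain ⟨t', M, x₀, -, hM, hsub', hbd', hx₀⟩ := hact K (max t₁ 0)
      ((le_max_left _ _).trans (le_max_left _ _)) (le_max_left _ _) (max_lt ht₁ hT)
      ⟨t, m t, ht₁t, hMt, hsub, hbd, hnr⟩
    -- shrink the active window from parameter `K` to parameter `k ≤ K`
    have hkK : (k : ℝ) * ν / M ^ 2 ≤ K * ν / M ^ 2 :=
      div_le_div_of_nonneg_right (mul_le_mul_of_nonneg_right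
        ((le_max_right k₀ (k : ℝ)).trans (le_max_left _ 1)) hν.le) (by positivity)
    refine ⟨t', M, x₀, hM, fun r hr => hsub' ⟨?_, ?_⟩, fun r hr x => hbd' r ⟨?_, ?_⟩ x, hx₀⟩ <;>
      linarith [hr.1, hr.2]
  -- the eternal limit and the Liouville contradiction
  obtain ⟨v, hv, hdiv, hmild, hbd, hgrad⟩ :=
    stub_activeWindowsGenerateNonconstant ν T hν hT u p hmax.1 hLH hdec ε hε hwin
  have h0 : fderiv ℝ (v 0) 0 = 0 := hEL v hv hdiv hmild ⟨1, hbd⟩ 0 0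
  rw [h0, norm_zero] at hgrad
  linarith

/-- **The crux from the stubs** (`TypeIliouvilleNoTypeII`, concluded BY NAME): STUBS 1–5. -/
theorem TypeIliouvilleNoTypeII_of :
    Summit.NavierStokesRegularity.NavierStokesRegularity.Theses.TypeILiouville.TypeIliouvilleNoTypeII :=
  TypeIliouvilleNoTypeII_of_windowActivity_of_eternalLiouville stub_windowActivity stub_eternalLiouville

/-- **The crux from (L)** (route `TypeILiouville` already carries (L) as item `TypeIliouvilleL`):
STUBS 1–4 and 6. -/
theorem TypeIliouvilleNoTypeII_of_L
    (hL : Summit.NavierStokesRegularity.NavierStokesRegularity.Theses.TypeILiouville.TypeIliouvilleL) :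
    Summit.NavierStokesRegularity.NavierStokesRegularity.Theses.TypeILiouville.TypeIliouvilleNoTypeII :=
  TypeIliouvilleNoTypeII_of_windowActivity_of_eternalLiouville stub_windowActivity
    (stub_eternalLiouville_of_liouvilleConjecture hL)

end Summit.NavierStokesRegularity.NavierStokesRegularity.Theorems

end
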